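import Summits.ResolutionOfSingularities.ResolutionOfSingularities.Theses.CleanCovers
import Summits.ResolutionOfSingularities.ResolutionOfSingularities.Theorems.CleanCoversKedlayaReduction
import Literature.AlgebraicGeometry.Motives.VarietiesProperProofs
import HarnessLib

/-!
# Crux `CleanCovers.CoverResolution` (stmt-ResolutionOfSingularities-15104), line `strategy-split`
# v2: CERTIFICATES — the exact logical position of the crux in the route

Route `ResolutionOfSingularities/CleanCovers`. Two certificates:

* `coverResolution_iff_resPerfect`: `CoverResolution ↔ ResPerfect`, where `ResPerfect` (written
  verbatim) says that for every prime `p`, every reduced separated scheme of finite type over every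
  perfect field of characteristic `p` has a resolution. `ResPerfect` is the consequent of the PROVED
  route item `KedlayaReduction` (`kedlayaReduction_proof`) and the antecedent of the open route item
  `DescentPerfectToAll`. Direction `→` is `kedlayaReduction_proof`; direction `←` forgets the cover:
  a Kedlaya cover `f : X → ℙⁿ_k` (`X` integral, `f` finite) is a reduced separated `k`-scheme of
  finite type through `f ≫ (ℙⁿ_k → Spec k)` (finite ⇒ proper; `ℙⁿ_k → Spec k` proper).
* `resolutionOfSingularities_of_coverResolution_of_descentPerfectToAll`: hence the route's deciding
  theorem `closes` needs only `CoverResolution` and `DescentPerfectToAll`.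
-/

-- single-problem summit: the doubled namespace component `ResolutionOfSingularities` is forced
set_option linter.dupNamespace false

namespace Summit.ResolutionOfSingularities.ResolutionOfSingularities.Theorems

open CategoryTheory AlgebraicGeometry Literature.AlgebraicGeometry.Resolution
open Summit.ResolutionOfSingularities.ResolutionOfSingularities.Theses.CleanCovers

/-- **Certificate: `CoverResolution ↔ ResPerfect`.** The crux (every integral scheme finite
surjective over `ℙⁿ_k`, `k` perfect of characteristic `p`, étale over the chart `D₊(xₙ)`, has a
resolution) is equivalent to resolution of every reduced separated scheme of finite type over every
perfect field of characteristic `p`. `→`: the proved crux `KedlayaReduction`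
(`kedlayaReduction_proof`). `←`: a Kedlaya cover `X → ℙⁿ_k` is itself a reduced (integral),
separated, quasi-compact `k`-scheme locally of finite type through `f ≫ (ℙⁿ_k → Spec k)` (finite ⇒
proper, and `ℙⁿ_k → Spec k` is proper); the étale and surjectivity hypotheses are not used.
[folklore] -/
theorem coverResolution_iff_resPerfect : Summit.ResolutionOfSingularities.ResolutionOfSingularities.Theses.CleanCovers.CoverResolution ↔ (∀ p : ℕ, p.Prime → ∀ (k : Type) [Field k] [CharP k p] [PerfectField k] (X : AlgebraicGeometry.Scheme.{0}) (f : X ⟶ AlgebraicGeometry.Spec (.of k)), AlgebraicGeometry.IsSeparated f → AlgebraicGeometry.LocallyOfFiniteType f → AlgebraicGeometry.QuasiCompact f → AlgebraicGeometry.IsReduced X → Literature.AlgebraicGeometry.Resolution.Scheme.HasResolution X) := by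
  refine ⟨fun hC p hp => kedlayaReduction_proof p hp (hC p hp), fun h => ?_⟩
  intro p hp k _ _ _ n X f hint hfin _ _
  haveI := hfin
  haveI := hint
  haveI : IsProper (Literature.AlgebraicGeometry.Motives.projectiveSpace n k).hom :=
    Literature.AlgebraicGeometry.Motives.isProper_projectiveSpace n k
  -- the `k`-structure of `X`
  let g : X ⟶ Spec (.of k) := f ≫ (Literature.AlgebraicGeometry.Motives.projectiveSpace n k).hom
  haveI : IsSeparated g := inferInstance
  haveI : LocallyOfFiniteType g := inferInstance
  haveI : QuasiCompact g := inferInstance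
  exact h p hp k X g inferInstance inferInstance inferInstance inferInstance

/-- **Certificate: the summit from `CoverResolution` and `DescentPerfectToAll` alone.** Since the
route item `KedlayaReduction` is proved in the tree (`kedlayaReduction_proof`), the route's deciding
theorem `closes` needs only the crux `CoverResolution` and the shared descent
`DescentPerfectToAll`. [folklore] -/
theorem resolutionOfSingularities_of_coverResolution_of_descentPerfectToAll : Summit.ResolutionOfSingularities.ResolutionOfSingularities.Theses.CleanCovers.CoverResolution → Summit.ResolutionOfSingularities.ResolutionOfSingularities.Theses.CleanCovers.DescentPerfectToAll → _root_.ResolutionOfSingularities :=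
  fun hC hD => closes hC kedlayaReduction_proof hD

end Summit.ResolutionOfSingularities.ResolutionOfSingularities.Theorems
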